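import Mathlib
import HarnessLib
import Literature.Analysis.FluidPDE.SuitableWeak
import Literature.Analysis.FluidPDE.MildSolution
import Literature.Analysis.FluidPDE.SelfSimilar
import Literature.Analysis.FluidPDE.AxisymmetricEuler
import Literature.Analysis.FluidPDE.AxisymmetricVorticityTransport
import Literature.Analysis.FluidPDE.RestrictedEulerDynamics
import Literature.Analysis.FluidPDE.AncientAxisymmetricTypeILiouville
import Summits.NavierStokesRegularity.NavierStokesRegularity.Theses.AngularGalerkinLadder
import Summits.NavierStokesRegularity.NavierStokesRegularity.Theorems.RungBlowupCofinal.Negative.KnssGuard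
import Summits.NavierStokesRegularity.NavierStokesRegularity.Theorems.RungBlowupCofinal.Negative.LinearStrainParasitic
import Summits.NavierStokesRegularity.NavierStokesRegularity.Theorems.RungBlowupCofinal.Negative.KnssTangentDecay

/-! # «HalfTurn» line (v4 CANDIDATE) for crux `RungBlowupCofinal` — the BC5 rung in a NON-axisymmetric degree-2 cell, with
the rotated-DSS TANGENT clause conjoined (item stmt-NavierStokesRegularity-19959, route
`route-NavierStokesRegularity-AngularGalerkinLadder` №8, card K1; bc5-witness planners `ns-agl-bc5w-19959-g0` (v1/v2) and `-g2`
(v4), refuter g14 (the v3 hunk), 2026-08-26/27; tribunal J r1 flag (b) «re-target the BC5 rung to a NON-axisymmetric degree-2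
cell»; T2 print map 404f50ebab86e783 §0; DIRECTOR-NS ns-blowup INBOX #11 (b), #6 (2), #10 (1); plan g21 STATUS l.6967 (4)).

LINE OF RECORD is v3 = tree `Cruxes/RungBlowupCofinal/Lines/halfturn.lean` (refuter g14's a6051f783d708c08 = v2 c02db4f8bb4b21be +
the centred KNSS rate R2; commit 7f34b7f6abd7; skeleton registered 2026-08-27T01:14Z: `stub_bc5_halfturn_two`,
`stub_halfturn_forward_cofinal`, `stub_halfturn_extraction`). THIS FILE (v4) = the v3 letter with THREE conjunct groups ADDED and
ONE stub RE-TYPED, written to plan g21's swap criterion (STATUS l.6967 (4): «HalfTurn becomes the line of record iff it ALSO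
conjoins the tangent clause; then `HalfTurnForwardBlowup L ⇒ RungForwardDSSBlowup L` by projection, HalfTurn REFINES birth v4, and
the extraction stub shrinks to closure + cell/germ passage, both with print roads»). Added:
* R1 `∀ t ∈ [0,T), MemLp (u t) 2 volume` (finite-energy slices, KJ-18 R1) and `¬ ∃ M, ∀ t ∈ [0,T), ∀ x, ‖u t x‖ ≤ M`
  (unbounded) — the two birth-v4 conjuncts v3 lacked (the second is DERIVED from the tangent clause, `unbounded_of_tangent`);
* the birth-v4 TANGENT clause verbatim (binders `C c R v lam`): `1 < c ∧ IsRotatedDSS c R v ∧ (∃ s < 0, ∃ y, v s y ≠ 0) ∧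
  (∀ n, 0 < lam n) ∧ Tendsto lam atTop (𝓝 0) ∧ ∀ s < 0, ∀ y, nsRescale (lam n) (u (T + ·)) s y ⟶ v s y` — the blow-up
  sequence ABOUT THE ORIGIN converges pointwise on the open past to a non-trivial rotated-DSS field `v`;
* the LIMIT GERM clause `∃ s < 0, DifferentiableAt ℝ (v s) 0 ∧ ∃ η > 0, IsTriaxial η (centreGradient (v s))` — the tangent
  flow itself carries the triaxial centre strain germ, so chain-liveness (no common axis) is read off `v` by
  `triaxial_noCommonAxis` and nothing has to be inferred from `u` in the limit.
Letter: `IsHalfTurnForwardBlowup L T C c R u p d v lam := IsForwardDSSBlowup L T C c R u p d v lam ∧ ⟨slices in the cell⟩ ∧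
IsTypeIBlowup u T ∧ ⟨κ: centre gradient at the Type-I rate, frequently⟩ ∧ ⟨η: triaxial germ of u, eventually⟩ ∧ ⟨limit germ⟩`,
`HalfTurnForwardBlowup L := ∃ T C c R u p d v lam, IsHalfTurnForwardBlowup …`, where `IsForwardDSSBlowup` /
`RungForwardDSSBlowup` are VERBATIM local copies of plan g21's birth-v4 letter (HOME/plan/agl/bc/RungBlowupCofinal_birth_v4.lean
ed1acbca05580398, namespace `…Cruxes.RungBlowupCofinal.Birth`; not an importable module today — once it is, the copies are
definitionally equal and `Iff.rfl` bridges them). EVERY v3 clause is KEPT: `HalfTurnForwardBlowupV3` below is the v3 letter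
verbatim and `HalfTurnForwardBlowup.toV3 : v4 ⇒ v3` is PROVED, so junk-freeness — monotone under adding conjuncts — carries
KJ-19 (CLEAN), KJ-20 (junk-free; p479287/p479890 `…/Negative/LinearStrainParasitic.lean`) and KJ-21 (p480997 `…/Negative/KnssGuard.lean`)
over to v4 without a re-run; `HalfTurnForwardBlowup.rungForwardDSSBlowup : v4 ⇒ RungForwardDSSBlowup L` (PROVED) is the projection
onto the birth-v4 forward letter (HalfTurn REFINES birth v4).

STUBS (3): `stub_bc5_halfturn_two : HalfTurnForwardBlowup 2` — THE RUNG, same NAME as v1–v3 (= the J fit-note witness decl),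
statement strengthened · `stub_halfturn_forward_cofinal` — same name (XL) · NEW `stub_halfturn_tangent_closure` = birth-v4
`stub_tangent_flow_closure` VERBATIM over the local copy (L; KNSS 2009 L.6.1 / Thm 6.2 for `NS_L` at fixed `L`: the GIVEN pointwise
blow-up limit is an ancient rung solution in the same envelope — ONE lemma serves both skeletons), REPLACING v3's
`stub_halfturn_extraction` (whose ∀-form «sup-norm Type-I ⇒ a DSS tangent» has no print road — J caveat (i) — and is not even
believed as a ∀-statement). REAL proofs new in v4: the envelope passes to the tangent with the same constant
(`IsForwardDSSBlowup.hasTypeIDecay`, = tree `hasTypeIDecay_tangent_of_knss`, KJ-23 p482353), the half-turn cell passes to the tangent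
(`inHalfTurnCell_of_tangent`: oddness and `rotZ π`-equivariance commute with `nsRescale` and are closed under pointwise limits),
the tangent forces unboundedness (`unbounded_of_tangent`), a triaxial germ forces differentiability and non-triviality of the slice
(`differentiableAt_of_isTriaxial`, `exists_ne_zero_of_isTriaxial`), the constructor's interface `HalfTurnForwardBlowup.of_core`
(the sup-norm clause — KJ-21 `isTypeIBlowup_of_knss` —, unboundedness and `v ≢ 0` are derived, not owed), the closure output ⇒
`HalfTurnSingularGerm L` (`halfTurnSingularGerm_of_closure`), the crux BY NAME (`RungBlowupCofinal_of_halfTurn`,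
`RungBlowupCofinal_skeleton_halfTurn`), and the instances the rung settles (`halfTurnSingular_two_of`,
`rungIsSingular_instances_of_two(_skeleton)`: BC5 + closure ⇒ a NON-axisymmetric singular rung-2 profile ⇒ every `L₀ ≤ 2`).

WHAT THIS IS NOT: not NS regularity and not a theorem about Navier–Stokes — a REGISTERED PLAN (named stubs + kernel-checked
compositions) about the angular Galerkin truncation `NS_L` of `FluidComputer/AngularGalerkinLadder.lean`. Sorries ONLY in `stub_*`.

## The cell
The **half-turn cell** of rung `L`: slices `v` that are ODD under central inversion (`v (−x) = −v x`) and equivariant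
under the half-turn `rotZ π` about the `x₃`-axis (`InHalfTurnCell`). It is the fixed set of the symmetry subgroup
`C_2h = {1, R_{e₃}(π), −1, σ_h} ⊂ O(3)`, hence invariant under the `O(3)`-covariant truncated dynamics
(`AngularLadder.IsRungSolutionOn.conj_linearIsometryEquiv` + uniqueness). At `L = 2`, in the equivariant variables of
HOME/circuit/agl/AGL-RUNG2-STRUCTURE.md §0 (`u = P₁[α] + T₁[β] + P₂[A] + T₂[B]`), oddness kills `α` and `B` and the
half-turn leaves `u = T₁[b(r) e₃] + P₂[A(r)]`, `A(r) ∈ Sym₀(3)` block-diagonal w.r.t. `e₃`: FOUR radial functions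
`(b; a₁₁, a₁₂, a₂₂)` — vertical differential rotation + a horizontally skewed quadrupole strain. `u(t, 0) = 0`
(`InHalfTurnCell.apply_zero`), `∇u(t, 0) = 3A(0,t) + [b(0,t) e₃]ₓ` carries BOTH centre strain and centre vorticity.
Sub-cells: the theorem-dead `m = 0` strain+swirl sector of circuit §3 (`a₁₁ = a₂₂`, `a₁₂ = 0`; MECHTOY-AGL-1 geometry) =
built-in CONTROL; the triaxial pure-strain sector (`b = a₁₂ = 0`, `D_2h`).

## Why this cell (planner's derivations, pen; numbers not adjectives)
* Closedness without symmetry bookkeeping: by circuit §1's channel table every source of `α` and of `B` carries a factor `α`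
  or `B`, so `{α = B = 0}` (= odd fields) is invariant for ALL `(β, A)`; the half-turn then restricts `β ∥ e₃`, `A` block-diagonal.
* Exact centre law of the odd cell (from §1 by parts; reproduces §3's `−15/14`, `−2/15` on `span{E}`):
  `Ȧ(0) = 7ν A″(0) − (15/7) sym₀(A(0)²) − (1/5) sym₀(β(0)⊗β(0)) + [β·A C-channel]`, `β̇(0) = 5ν β″(0) + 3A(0)β(0)` —
  renormalised restricted Euler (`Literature/Analysis/FluidPDE/RestrictedEulerDynamics.lean`: `RestrictedEuler.field`,
  `IsRestrictedEulerSolutionOn.time_lt_of_*`, coefficient `κ₁ = 5/7` of Vieillefosse's `1`).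
* Germ rigidity (why non-axisymmetry is an OUTPUT clause, not a property of the cell): with `κ₁ ≠ 1` the inviscid LOCAL law
  has no Type-I similarity germ with co-blowing vorticity and its pure-strain germs have a repeated eigenvalue
  (`(μ₁ − μ₂)(1 − κ₁ a) = 0`), i.e. the inviscid centre germ is the axisymmetric `(1,1,−2)/κ₁` collapse; viscosity enters the
  germ balance at `O(1)` through the free profile curvature `7𝒜″(0)`, so viscous profiles are unconstrained at the germ. And:
  every subgroup `G ⊂ O(3)` with a non-zero invariant in isotypes `≤ 2` fixes a line, so NO symmetry class of degree `≤ 2`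
  FORCES non-axisymmetry. Hence the rung certifies non-axisymmetry on the blow-up itself: a uniformly TRIAXIAL centre strain
  germ (`IsTriaxial`: normalised discriminant floor, scale-invariant), which passes to tangent flows and forbids every axis
  (`triaxial_noCommonAxis`, PROVED in §2b).
* Chain-liveness at the NS end (K3's output class). Theorem-dead strata: axisymmetric about some axis (KNSS 2009 Thm 5.3;
  tree `Literature.Analysis.FluidPDE.not_typeI_rdss_profile_of_isAxisymmetric_conj`) and PLAIN self-similar with Type-I decay
  (Tsai 1998 Thm 1, `U ∈ L^q`, `3 < q ≤ ∞`; tree fact `Literature.NS.tsai_selfsimilar`); OPEN in print: rotated self-similar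
  (RSS) under `|u| ≤ C/(|x|+√−t)` and DSS with factor not close to `1` (Bradshaw–Tsai survey arXiv:1802.00038 p. 3; Chae–Wolf
  2017 CPDE kills DSS with `λ − 1 ≤ δ(N)`). The natural output of the half-turn cell is RSS — strain eigenframe precessing about
  the vorticity axis `e₃` (the `C(β, A)` channel) — which needs centre vorticity: this is why the cell keeps `b` and is not the
  vorticity-free triaxial `D_2h` cell, whose natural steady similarity profiles are plain SS (Tsai-shadowed). `HalfTurnSingularRSS`
  records the Tsai-live refinement (`¬ IsSelfSimilar`).

## Stubs (3) and compositions (v4)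
`stub_bc5_halfturn_two : HalfTurnForwardBlowup 2` — THE BC5 RUNG (T3 plan-only; first prover target of route №8);
`stub_halfturn_forward_cofinal` (XL, K1's physics bet inside the cell); `stub_halfturn_tangent_closure` (L; = birth-v4
`stub_tangent_flow_closure`: the given pointwise blow-up limit of a finite-energy centred-Type-I rung-`L` solution is an ancient
rung-`L` solution — KNSS L.6.1 run for the truncation at fixed `L`; its `HasTypeIDecay C v` conjunct is free by
`IsForwardDSSBlowup.hasTypeIDecay`). Proved: `triaxial_noCommonAxis` (§2b, v2), the §2a tangent lemmas, `HalfTurnForwardBlowup.of_core`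
/ `.toV3` / `.rungForwardDSSBlowup`, `halfTurnSingularGerm_of_closure`, `HalfTurnSingularGerm.halfTurnSingular`,
`HalfTurnSingular.rungIsSingular`, `halfTurnSingular_two_of`, `rungIsSingular_instances_of_two(_skeleton)`,
`RungBlowupCofinal_of_halfTurn` (the crux BY NAME), `RungBlowupCofinal_skeleton_halfTurn`.

BC5 line (D-0033 T3): `bc5: RungBlowupCofinal: plan-only stub_bc5_halfturn_two : HalfTurnForwardBlowup 2 via a Chen–Hou-type
computer-assisted construction of an approximately (rotated-)self-similar Type-I blow-up for the 4-function radial system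
(b; a₁₁, a₁₂, a₂₂)(r, t) of NS_2's half-turn cell (steady state of the similarity dynamics in a frame precessing about e₃ +
linearised stability ⇒ the finite-energy truncation converges to the profile in similarity variables: that IS the tangent clause,
with v the (rotated-)self-similar profile flow and its triaxial centre germ) — why C not S: one instance (L = 2, forward half) of
K1 about the truncated system NS_2 only; Clay (C) has no proved regime; chain-live (avoids the KNSS and Tsai strata by the
triaxial germ / precession)`. -/

set_option linter.dupNamespace false

namespace Summit.NavierStokesRegularity.NavierStokesRegularity.Cruxes.RungBlowupCofinal.HalfTurn

open scoped Topology
open scoped Matrix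
open Filter Set MeasureTheory
open Summit.NavierStokesRegularity.FluidComputer
open Literature.Analysis.FluidPDE

local notation "ℝ³" => EuclideanSpace ℝ (Fin 3)

/-- The crux behind a local abbreviation (audit shape, cf. plan g20 README-EDIT § Turnkey A′): the explicit-hypothesis
composition `RungBlowupCofinal_of_halfTurn` concludes `Goal`, so the ONLY theorem of this file concluding the crux constant BY
NAME is the hypothesis-free `RungBlowupCofinal_skeleton_halfTurn` (A12 `#h21_check_skeleton` takes the first candidate). -/
abbrev Goal : Prop := Summit.NavierStokesRegularity.NavierStokesRegularity.Theses.AngularGalerkinLadder.RungBlowupCofinal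

/-! ## §1 The half-turn cell and the centre germ -/

/-- The **half-turn cell**: `v` is odd under central inversion, `v (−x) = −v x` (no `P₁`/`T₂` components: `α = B = 0`),
and equivariant under the half-turn `R_{e₃}(π) = rotZ π`, `v (Rx) = R (v x)` (`β ∥ e₃`, `A` block-diagonal). The fixed set
of `C_2h ⊂ O(3)`; at rung 2 the 4-function radial system `(b; a₁₁, a₁₂, a₂₂)`. -/
def InHalfTurnCell (v : ℝ³ → ℝ³) : Prop :=
  (∀ x, v (-x) = -v x) ∧ ∀ x, v (rotZ Real.pi x) = rotZ Real.pi (v x)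

/-- The zero field lies in the cell. -/
theorem inHalfTurnCell_zero : InHalfTurnCell (fun _ : ℝ³ => (0 : ℝ³)) := by
  refine ⟨fun x => by simp, fun x => ?_⟩
  ext i
  fin_cases i <;> simp [rotZ]

/-- A field of the cell vanishes at the centre (oddness): the rung therefore reads the blow-up off the
velocity GRADIENT at the origin, `∇u(t,0) = 3A(0,t) + [b(0,t)e₃]ₓ`. -/
theorem InHalfTurnCell.apply_zero {v : ℝ³ → ℝ³} (h : InHalfTurnCell v) : v 0 = 0 := by
  have h0 : v 0 = -v 0 := by simpa using h.1 0
  have h2 : (2 : ℝ) • v 0 = 0 := by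
    rw [two_smul]
    nth_rewrite 2 [h0]
    exact add_neg_cancel (v 0)
  rcases smul_eq_zero.mp h2 with h | h
  · norm_num at h
  · exact h

/-- The axisymmetric (`m = 0` about `e₃`) odd fields — circuit §3's strain+swirl sector `{β = b e₃, A = a E}` — lie
INSIDE the cell: the theorem-dead control stratum is a sub-cell, not excluded by the cell. -/
theorem inHalfTurnCell_of_isAxisymmetric_of_odd {v : ℝ³ → ℝ³} (hax : IsAxisymmetric v)
    (hodd : ∀ x, v (-x) = -v x) : InHalfTurnCell v :=
  ⟨hodd, fun x => hax Real.pi x⟩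

/-- The **centre velocity-gradient matrix** `M_{ij} = ∂_j v_i (0)`. -/
noncomputable def centreGradient (v : ℝ³ → ℝ³) : Matrix (Fin 3) (Fin 3) ℝ :=
  Matrix.of fun i j => (fderiv ℝ v 0 (EuclideanSpace.single j (1 : ℝ))) i

/-- The **strain germ**: symmetric trace-free part `sym₀ M = ½(M + Mᵀ) − (tr M / 3)·1`. -/
noncomputable def strainPart (M : Matrix (Fin 3) (Fin 3) ℝ) : Matrix (Fin 3) (Fin 3) ℝ :=
  (1 / 2 : ℝ) • (M + Mᵀ) - (M.trace / 3) • (1 : Matrix (Fin 3) (Fin 3) ℝ)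

/-- **Uniform triaxiality** of a velocity-gradient matrix `M` with floor `η`: `M ≠ 0` (Frobenius `tr(MᵀM) > 0`) and the
discriminant `D = Q³ + (27/4)R²` of its strain germ (`VelocityGradient.discr`, `= −¼∏(λᵢ − λⱼ)² ≤ 0` for symmetric
trace-free germs, `< 0` iff the three strain eigenvalues are DISTINCT) obeys `D ≤ −η · (tr MᵀM)³`. Both sides are
homogeneous of degree 6 in `M`: the condition is invariant under the Type-I rescaling `M ↦ c M` and passes to `C¹` limits.
Triaxial ⇔ «`m ≠ 0` about EVERY axis» at the germ. -/
def IsTriaxial (η : ℝ) (M : Matrix (Fin 3) (Fin 3) ℝ) : Prop :=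
  0 < (Mᵀ * M).trace ∧ VelocityGradient.discr (strainPart M) ≤ -η * ((Mᵀ * M).trace) ^ 3

/-! ## §2 The rung (forward form) and its profile forms -/

/-- **Birth-v4 forward datum — VERBATIM local copy of `…Cruxes.RungBlowupCofinal.Birth.IsForwardDSSBlowup`** (plan g21,
HOME/plan/agl/bc/RungBlowupCofinal_birth_v4.lean ed1acbca05580398; KJ-18 R1 ∧ R2 + the rotated-DSS tangent clause): a rung-`L`
Cauchy solution on `[0, T)` (`ν = 1`) from smooth rapidly decaying band-limited data, finite-energy slices (R1), inside the
centred KNSS envelope `‖u t x‖ ≤ C / (‖x‖ + √(T − t))` (R2, GLOBAL in `x`), unbounded, whose blow-up sequence about the ORIGIN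
`λₙ u(T + λₙ² s, λₙ y)`, `λₙ → 0⁺`, converges pointwise on the open past to a non-trivial rotated-DSS field `v` (factor `c > 1`,
rotation `R`). Kept as a copy (not an import) because `Lines/birth.lean` v4 is not an importable module; the two are
definitionally equal. -/
def IsForwardDSSBlowup (L : ℕ) (T C c : ℝ) (R : ℝ³ ≃ₗᵢ[ℝ] ℝ³)
    (u : ℝ → ℝ³ → ℝ³) (p : ℝ → ℝ³ → ℝ) (d : ℝ → ℝ³ → ℝ³) (v : ℝ → ℝ³ → ℝ³) (lam : ℕ → ℝ) : Prop :=
  0 < T ∧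
    AngularLadder.IsRungSolutionOn (Set.Ico 0 T) 1 L u p d ∧
    ContDiff ℝ (⊤ : ℕ∞) (u 0) ∧ HasRapidSpatialDecay (u 0) ∧
    (∀ t ∈ Set.Ico 0 T, MemLp (u t) 2 (volume : Measure ℝ³)) ∧
    (∀ t ∈ Set.Ico 0 T, ∀ x, ‖u t x‖ ≤ C / (‖x‖ + Real.sqrt (T - t))) ∧
    (¬ ∃ M : ℝ, ∀ t ∈ Set.Ico 0 T, ∀ x, ‖u t x‖ ≤ M) ∧
    1 < c ∧ IsRotatedDSS c R v ∧ (∃ s < 0, ∃ y, v s y ≠ 0) ∧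
    (∀ n, 0 < lam n) ∧ Tendsto lam atTop (𝓝 0) ∧
    ∀ s < 0, ∀ y, Tendsto (fun n => nsRescale (lam n) (fun t x => u (T + t) x) s y) atTop (𝓝 (v s y))

/-- **VERBATIM local copy of `…Birth.RungForwardDSSBlowup`** (the birth-v4 forward letter at level `L`). -/
def RungForwardDSSBlowup (L : ℕ) : Prop :=
  ∃ (T C c : ℝ) (R : ℝ³ ≃ₗᵢ[ℝ] ℝ³) (u : ℝ → ℝ³ → ℝ³) (p : ℝ → ℝ³ → ℝ) (d : ℝ → ℝ³ → ℝ³)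
    (v : ℝ → ℝ³ → ℝ³) (lam : ℕ → ℝ), IsForwardDSSBlowup L T C c R u p d v lam

/-- **The v4 half-turn forward datum** `IsHalfTurnForwardBlowup L T C c R u p d v lam`: the birth-v4 datum AND every slice in
the half-turn cell AND the (kept, redundant under R2, never to be localised) sup-norm Type-I clause AND the centre gradient at
the Type-I rate along a sequence of times (`κ ≤ (T − t)‖∇u(t)(0)‖` frequently as `t ↑ T`) AND a uniformly triaxial centre strain
germ of `u` near `T` AND — new in v4 — a TRIAXIAL centre strain germ of the TANGENT FLOW `v` on some slice `s < 0`. -/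
def IsHalfTurnForwardBlowup (L : ℕ) (T C c : ℝ) (R : ℝ³ ≃ₗᵢ[ℝ] ℝ³)
    (u : ℝ → ℝ³ → ℝ³) (p : ℝ → ℝ³ → ℝ) (d : ℝ → ℝ³ → ℝ³) (v : ℝ → ℝ³ → ℝ³) (lam : ℕ → ℝ) : Prop :=
  IsForwardDSSBlowup L T C c R u p d v lam ∧
    (∀ t ∈ Set.Ico 0 T, InHalfTurnCell (u t)) ∧
    IsTypeIBlowup u T ∧
    (∃ κ : ℝ, 0 < κ ∧ ∃ᶠ t in 𝓝[<] T, κ ≤ (T - t) * ‖fderiv ℝ (u t) 0‖) ∧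
    (∃ η : ℝ, 0 < η ∧ ∀ᶠ t in 𝓝[<] T, IsTriaxial η (centreGradient (u t))) ∧
    (∃ s < 0, DifferentiableAt ℝ (v s) 0 ∧ ∃ η : ℝ, 0 < η ∧ IsTriaxial η (centreGradient (v s)))

/-- **THE BC5 RUNG, forward form, at level `L` — `HalfTurnForwardBlowup L` (v4).** A rung-`L` solution of the Cauchy problem
on `[0, T)` (`ν = 1`) from smooth rapidly decaying band-limited data, every slice in the half-turn cell, finite-energy and inside
the centred KNSS envelope, blowing up AT THE ORIGIN with a non-trivial rotated-DSS tangent flow whose centre strain germ is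
TRIAXIAL (chain-live: no axis of axisymmetry survives, `triaxial_noCommonAxis`). The instance `L = 2` is the first prover target
of route №8; the constructor's interface is `HalfTurnForwardBlowup.of_core`. -/
def HalfTurnForwardBlowup (L : ℕ) : Prop :=
  ∃ (T C c : ℝ) (R : ℝ³ ≃ₗᵢ[ℝ] ℝ³) (u : ℝ → ℝ³ → ℝ³) (p : ℝ → ℝ³ → ℝ) (d : ℝ → ℝ³ → ℝ³)
    (v : ℝ → ℝ³ → ℝ³) (lam : ℕ → ℝ), IsHalfTurnForwardBlowup L T C c R u p d v lam

/-- **The v3 letter of record, VERBATIM** (tree `Lines/halfturn.lean` a6051f783d708c08, decl `HalfTurnForwardBlowup` there),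
kept under this name so that the monotonicity v4 ⇒ v3 is a theorem of this file (`HalfTurnForwardBlowup.toV3`): every family
certified NOT to inhabit the v3 letter (KJ-18/19/20/21) does not inhabit v4. -/
def HalfTurnForwardBlowupV3 (L : ℕ) : Prop :=
  ∃ (T : ℝ) (u : ℝ → ℝ³ → ℝ³) (p : ℝ → ℝ³ → ℝ) (d : ℝ → ℝ³ → ℝ³), 0 < T ∧
    AngularLadder.IsRungSolutionOn (Set.Ico 0 T) 1 L u p d ∧
    ContDiff ℝ (⊤ : ℕ∞) (u 0) ∧ HasRapidSpatialDecay (u 0) ∧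
    (∀ t ∈ Set.Ico 0 T, InHalfTurnCell (u t)) ∧
    IsTypeIBlowup u T ∧
    (∃ C : ℝ, ∀ t ∈ Set.Ico 0 T, ∀ x, ‖u t x‖ ≤ C / (‖x‖ + Real.sqrt (T - t))) ∧
    (∃ κ : ℝ, 0 < κ ∧ ∃ᶠ t in 𝓝[<] T, κ ≤ (T - t) * ‖fderiv ℝ (u t) 0‖) ∧
    (∃ η : ℝ, 0 < η ∧ ∀ᶠ t in 𝓝[<] T, IsTriaxial η (centreGradient (u t)))

/-- **Monotonicity v4 ⇒ v3** (real proof, projection): the junk-freeness records of v3 carry over. -/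
theorem HalfTurnForwardBlowup.toV3 {L : ℕ} (h : HalfTurnForwardBlowup L) : HalfTurnForwardBlowupV3 L := by
  obtain ⟨T, C, c, R, u, p, d, v, lam, hF, hcell, hTI, hκ, hη, -⟩ := h
  obtain ⟨hT, hsol, hsm, hdec, -, hR2, -⟩ := hF
  exact ⟨T, u, p, d, hT, hsol, hsm, hdec, hcell, hTI, ⟨C, hR2⟩, hκ, hη⟩

/-- **HalfTurn REFINES birth v4** (real proof, projection; plan g21's criterion l.6967 (4)): the v4 rung letter implies the
birth-v4 forward letter at the same level. -/
theorem HalfTurnForwardBlowup.rungForwardDSSBlowup {L : ℕ} (h : HalfTurnForwardBlowup L) : RungForwardDSSBlowup L := by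
  obtain ⟨T, C, c, R, u, p, d, v, lam, hF, -⟩ := h
  exact ⟨T, C, c, R, u, p, d, v, lam, hF⟩

/-! ## §2a The tangent clause at work (real proofs): blow-up times, envelope, cell, unboundedness, germ -/

/-- The rescaled field about `(T, 0)`, unfolded: `(nsRescale λ u(T + ·)) s y = λ u(T + λ² s, λ y)`. -/
theorem nsRescale_shift_apply (lam T : ℝ) (u : ℝ → ℝ³ → ℝ³) (s : ℝ) (y : ℝ³) :
    nsRescale lam (fun t x => u (T + t) x) s y = lam • u (T + lam ^ 2 * s) (lam • y) := rfl

/-- Blow-up times seen by the rescaling: for `s < 0` and `λₙ → 0⁺`, eventually `T + λₙ² s ∈ [0, T)`. -/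
theorem eventually_mem_Ico_of_tendsto {T : ℝ} (hT : 0 < T) {lam : ℕ → ℝ} (hpos : ∀ n, 0 < lam n)
    (hlam : Tendsto lam atTop (𝓝 0)) {s : ℝ} (hs : s < 0) :
    ∀ᶠ n in atTop, T + lam n ^ 2 * s ∈ Set.Ico 0 T := by
  have h1 : Tendsto (fun n => T + lam n ^ 2 * s) atTop (𝓝 T) := by
    have h : Tendsto (fun n => T + lam n ^ 2 * s) atTop (𝓝 (T + 0 ^ 2 * s)) :=
      tendsto_const_nhds.add ((hlam.pow 2).mul_const s)
    simpa using h
  filter_upwards [h1.eventually (lt_mem_nhds hT)] with n hn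
  refine ⟨hn.le, ?_⟩
  have : lam n ^ 2 * s < 0 := mul_neg_of_pos_of_neg (pow_pos (hpos n) 2) hs
  linarith

/-- **The envelope passes to the tangent flow with the SAME constant** — the `HasTypeIDecay C v` conjunct of the closure stub
is FREE: this is the tree theorem `RungBlowupCofinalKnssTangentDecay.hasTypeIDecay_tangent_of_knss` (refuter g14, KJ-23,
p482353, `--supports 19959`) read on the letter (R2 is inherited by every rescaling `λ u(T + λ²s, λ y)` as soon as
`λ²(−s) < T`, and norm bounds pass to pointwise limits). Cited, not re-proved. -/
theorem IsForwardDSSBlowup.hasTypeIDecay {L : ℕ} {T C c : ℝ} {R : ℝ³ ≃ₗᵢ[ℝ] ℝ³} {u : ℝ → ℝ³ → ℝ³}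
    {p : ℝ → ℝ³ → ℝ} {d : ℝ → ℝ³ → ℝ³} {v : ℝ → ℝ³ → ℝ³} {lam : ℕ → ℝ}
    (h : IsForwardDSSBlowup L T C c R u p d v lam) : HasTypeIDecay C v := by
  obtain ⟨hT, -, -, -, -, hR2, -, -, -, -, hpos, hlam, hlim⟩ := h
  exact Summit.NavierStokesRegularity.RungBlowupCofinalKnssTangentDecay.hasTypeIDecay_tangent_of_knss hT hR2 hpos hlam hlim

/-- **The half-turn cell passes to the tangent flow**: oddness and `rotZ π`-equivariance are LINEAR closed conditions, they
commute with the rescaling `λ u(T + λ²s, λ ·)` about the origin and survive pointwise limits. -/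
theorem inHalfTurnCell_of_tangent {T : ℝ} (hT : 0 < T) {u v : ℝ → ℝ³ → ℝ³} {lam : ℕ → ℝ}
    (hcell : ∀ t ∈ Set.Ico 0 T, InHalfTurnCell (u t)) (hpos : ∀ n, 0 < lam n) (hlam : Tendsto lam atTop (𝓝 0))
    (hlim : ∀ s < 0, ∀ y, Tendsto (fun n => nsRescale (lam n) (fun t x => u (T + t) x) s y) atTop (𝓝 (v s y))) :
    ∀ s < 0, InHalfTurnCell (v s) := by
  intro s hs
  have hev := eventually_mem_Ico_of_tendsto hT hpos hlam hs
  refine ⟨fun y => ?_, fun y => ?_⟩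
  · -- oddness
    have h1 : Tendsto (fun n => nsRescale (lam n) (fun t x => u (T + t) x) s (-y)) atTop (𝓝 (-v s y)) := by
      refine ((hlim s hs y).neg).congr' ?_
      filter_upwards [hev] with n hn
      rw [nsRescale_shift_apply, nsRescale_shift_apply, smul_neg (lam n) y, (hcell _ hn).1, smul_neg]
    exact tendsto_nhds_unique (hlim s hs (-y)) h1
  · -- half-turn equivariance
    have hc : Continuous (rotZ Real.pi) := (rotZL Real.pi).continuous.congr fun x => rfl
    have h1 : Tendsto (fun n => nsRescale (lam n) (fun t x => u (T + t) x) s (rotZ Real.pi y)) atTop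
        (𝓝 (rotZ Real.pi (v s y))) := by
      refine ((hc.tendsto _).comp (hlim s hs y)).congr' ?_
      filter_upwards [hev] with n hn
      have hlin : lam n • rotZ Real.pi y = rotZ Real.pi (lam n • y) := by
        simpa only [rotZL_apply] using ((rotZL Real.pi).map_smul (lam n) y).symm
      show rotZ Real.pi (nsRescale (lam n) (fun t x => u (T + t) x) s y) =
        nsRescale (lam n) (fun t x => u (T + t) x) s (rotZ Real.pi y)
      rw [nsRescale_shift_apply, nsRescale_shift_apply, hlin, (hcell _ hn).2]
      simpa only [rotZL_apply] using (rotZL Real.pi).map_smul (lam n) (u (T + lam n ^ 2 * s) (lam n • y))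
    exact tendsto_nhds_unique (hlim s hs _) h1

/-- **A non-trivial tangent forces unboundedness**: if `‖u‖ ≤ M` on `[0, T) × ℝ³` then every rescaled value
`λₙ u(T + λₙ² s, λₙ y)` is `≤ λₙ M → 0`, so `v ≡ 0` on the open past. -/
theorem unbounded_of_tangent {T : ℝ} (hT : 0 < T) {u v : ℝ → ℝ³ → ℝ³} {lam : ℕ → ℝ}
    (hpos : ∀ n, 0 < lam n) (hlam : Tendsto lam atTop (𝓝 0))
    (hlim : ∀ s < 0, ∀ y, Tendsto (fun n => nsRescale (lam n) (fun t x => u (T + t) x) s y) atTop (𝓝 (v s y)))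
    (hnz : ∃ s < 0, ∃ y, v s y ≠ 0) :
    ¬ ∃ M : ℝ, ∀ t ∈ Set.Ico 0 T, ∀ x, ‖u t x‖ ≤ M := by
  rintro ⟨M, hM⟩
  obtain ⟨s, hs, y, hy⟩ := hnz
  have hM0 : Tendsto (fun n => lam n * M) atTop (𝓝 0) := by
    simpa using hlam.mul_const M
  have h0 : Tendsto (fun n => nsRescale (lam n) (fun t x => u (T + t) x) s y) atTop (𝓝 0) := by
    refine squeeze_zero_norm' ?_ hM0
    filter_upwards [eventually_mem_Ico_of_tendsto hT hpos hlam hs] with n hn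
    rw [nsRescale_shift_apply, norm_smul, Real.norm_of_nonneg (hpos n).le]
    exact mul_le_mul_of_nonneg_left (hM _ hn _) (hpos n).le
  exact hy (tendsto_nhds_unique (hlim s hs y) h0)

/-- A triaxial centre germ forces differentiability at the centre (else `fderiv = 0` and the Frobenius floor fails). -/
theorem differentiableAt_of_isTriaxial {w : ℝ³ → ℝ³} {η : ℝ} (h : IsTriaxial η (centreGradient w)) :
    DifferentiableAt ℝ w 0 := by
  by_contra hnd
  have h0 : centreGradient w = 0 := by
    ext i j
    simp [centreGradient, fderiv_zero_of_not_differentiableAt hnd]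
  have hpos := h.1
  rw [h0] at hpos
  simp at hpos

/-- A triaxial centre germ forces the slice to be non-trivial (a zero slice has zero centre gradient). -/
theorem exists_ne_zero_of_isTriaxial {w : ℝ³ → ℝ³} {η : ℝ} (h : IsTriaxial η (centreGradient w)) : ∃ y, w y ≠ 0 := by
  by_contra hzero
  have hw : w = fun _ => (0 : ℝ³) := by
    funext y
    by_contra hy
    exact hzero ⟨y, hy⟩
  have h0 : centreGradient w = 0 := by
    ext i j
    simp [centreGradient, hw]
  have hpos := h.1
  rw [h0] at hpos
  simp at hpos

/-- **The constructor's interface** (real proof): to inhabit `HalfTurnForwardBlowup L` it suffices to supply the rung solution and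
its datum, R1, R2, the cell, the DSS data `(c, R)` of the limit field `v`, the scales `λₙ → 0⁺` with pointwise convergence on the
open past, the two centre clauses of `u` near `T`, and a triaxial centre germ of `v` on one slice; the sup-norm clause
(KJ-21 `RungBlowupCofinalKnssGuard.isTypeIBlowup_of_knss`), unboundedness (`unbounded_of_tangent`), non-triviality and
differentiability of the slice of `v` (`exists_ne_zero_of_isTriaxial`, `differentiableAt_of_isTriaxial`) are DERIVED. -/
theorem HalfTurnForwardBlowup.of_core {L : ℕ} {T C c : ℝ} {R : ℝ³ ≃ₗᵢ[ℝ] ℝ³} {u : ℝ → ℝ³ → ℝ³} {p : ℝ → ℝ³ → ℝ}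
    {d : ℝ → ℝ³ → ℝ³} {v : ℝ → ℝ³ → ℝ³} {lam : ℕ → ℝ}
    (hT : 0 < T) (hsol : AngularLadder.IsRungSolutionOn (Set.Ico 0 T) 1 L u p d)
    (hsm : ContDiff ℝ (⊤ : ℕ∞) (u 0)) (hdec : HasRapidSpatialDecay (u 0))
    (hR1 : ∀ t ∈ Set.Ico 0 T, MemLp (u t) 2 (volume : Measure ℝ³))
    (hR2 : ∀ t ∈ Set.Ico 0 T, ∀ x, ‖u t x‖ ≤ C / (‖x‖ + Real.sqrt (T - t)))
    (hcell : ∀ t ∈ Set.Ico 0 T, InHalfTurnCell (u t))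
    (hc : 1 < c) (hdss : IsRotatedDSS c R v)
    (hpos : ∀ n, 0 < lam n) (hlam : Tendsto lam atTop (𝓝 0))
    (hlim : ∀ s < 0, ∀ y, Tendsto (fun n => nsRescale (lam n) (fun t x => u (T + t) x) s y) atTop (𝓝 (v s y)))
    (hκ : ∃ κ : ℝ, 0 < κ ∧ ∃ᶠ t in 𝓝[<] T, κ ≤ (T - t) * ‖fderiv ℝ (u t) 0‖)
    (hη : ∃ η : ℝ, 0 < η ∧ ∀ᶠ t in 𝓝[<] T, IsTriaxial η (centreGradient (u t)))
    (hgerm : ∃ s < 0, ∃ η : ℝ, 0 < η ∧ IsTriaxial η (centreGradient (v s))) :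
    HalfTurnForwardBlowup L := by
  obtain ⟨s, hs, η, hη0, htri⟩ := hgerm
  have hnz : ∃ s < 0, ∃ y, v s y ≠ 0 := ⟨s, hs, exists_ne_zero_of_isTriaxial htri⟩
  exact ⟨T, C, c, R, u, p, d, v, lam,
    ⟨hT, hsol, hsm, hdec, hR1, hR2, unbounded_of_tangent hT hpos hlam hlim hnz, hc, hdss, hnz, hpos, hlam, hlim⟩,
    hcell, Summit.NavierStokesRegularity.RungBlowupCofinalKnssGuard.isTypeIBlowup_of_knss hT hR2, hκ, hη,
    s, hs, differentiableAt_of_isTriaxial htri, η, hη0, htri⟩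
/-- **No common axis**: there is no line `A e₃` about which every slice `u t`, `t < 0`, is axisymmetric — LITERALLY the
negation of the extra hypothesis of the tree no-go `not_typeI_rdss_profile_of_isAxisymmetric_conj` (KNSS 2009 Thm 5.3). -/
def NoCommonAxis (u : ℝ → ℝ³ → ℝ³) : Prop :=
  ¬ ∃ A : ℝ³ ≃ₗᵢ[ℝ] ℝ³, ∀ t < 0, IsAxisymmetric (fun x => A.symm (u t (A x)))

/-- **Singular half-turn rung profile** (profile form of the rung at level `L`): a Type-I rotated-DSS ancient rung-`L` profile
(`AngularLadder.IsRungProfile`), slices in the half-turn cell, not identically zero, with NO common axis of axisymmetry.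
An instance of `AngularLadder.RungIsSingular L` (`HalfTurnSingular.rungIsSingular`) lying outside the KNSS-dead stratum. -/
def HalfTurnSingular (L : ℕ) : Prop :=
  ∃ (C₀ c : ℝ) (R : ℝ³ ≃ₗᵢ[ℝ] ℝ³) (u : ℝ → ℝ³ → ℝ³) (p : ℝ → ℝ³ → ℝ) (d : ℝ → ℝ³ → ℝ³),
    AngularLadder.IsRungProfile L C₀ c R u p d ∧ (∀ t < 0, InHalfTurnCell (u t)) ∧
    (∃ t < 0, ∃ x, u t x ≠ 0) ∧ NoCommonAxis u

/-- **Germ form** (what the extraction delivers): as `HalfTurnSingular`, with the non-axisymmetry clause replaced by a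
TRIAXIAL centre strain germ on some slice `t₀ < 0` (differentiable there). -/
def HalfTurnSingularGerm (L : ℕ) : Prop :=
  ∃ (C₀ c : ℝ) (R : ℝ³ ≃ₗᵢ[ℝ] ℝ³) (u : ℝ → ℝ³ → ℝ³) (p : ℝ → ℝ³ → ℝ) (d : ℝ → ℝ³ → ℝ³),
    AngularLadder.IsRungProfile L C₀ c R u p d ∧ (∀ t < 0, InHalfTurnCell (u t)) ∧
    ∃ t₀ < 0, DifferentiableAt ℝ (u t₀) 0 ∧ ∃ η : ℝ, 0 < η ∧ IsTriaxial η (centreGradient (u t₀))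

/-- **Tsai-live refinement** (`⁺`): additionally the profile is NOT plain self-similar (`¬ IsSelfSimilar`): rotated
self-similar with non-zero precession, or genuinely discretely self-similar — the classes print leaves OPEN at the NS end
(Bradshaw–Tsai survey arXiv:1802.00038 p. 3), whereas plain SS Type-I profiles are Tsai-dead there. -/
def HalfTurnSingularRSS (L : ℕ) : Prop :=
  ∃ (C₀ c : ℝ) (R : ℝ³ ≃ₗᵢ[ℝ] ℝ³) (u : ℝ → ℝ³ → ℝ³) (p : ℝ → ℝ³ → ℝ) (d : ℝ → ℝ³ → ℝ³),
    AngularLadder.IsRungProfile L C₀ c R u p d ∧ (∀ t < 0, InHalfTurnCell (u t)) ∧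
    (∃ t < 0, ∃ x, u t x ≠ 0) ∧ NoCommonAxis u ∧ ¬ IsSelfSimilar u

/-! ## §2b The germ lemma — prover ask P0, PROVED here (v2): a triaxial strain germ at the origin forbids axisymmetry
about every line through the origin. Matrix algebra first. -/

/-- A matrix commuting with the quarter-turn about `e₃` has an axisymmetric strain germ. -/
theorem strainPart_eq_diagonal_of_rel (M : Matrix (Fin 3) (Fin 3) ℝ)
    (h01 : M 0 1 = -M 1 0) (h11 : M 1 1 = M 0 0) (h02 : M 0 2 = 0) (h12 : M 1 2 = 0)
    (h20 : M 2 0 = 0) (h21 : M 2 1 = 0) :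
    strainPart M =
      Matrix.diagonal ![(M 0 0 - M 2 2) / 3, (M 0 0 - M 2 2) / 3, -(2 * ((M 0 0 - M 2 2) / 3))] := by
  ext i j
  fin_cases i <;> fin_cases j <;>
    simp [strainPart, Matrix.diagonal, Matrix.trace_fin_three, h01, h11, h02, h12, h20, h21] <;>
    ring

theorem discr_strainPart_eq_zero_of_rel (M : Matrix (Fin 3) (Fin 3) ℝ)
    (h01 : M 0 1 = -M 1 0) (h11 : M 1 1 = M 0 0) (h02 : M 0 2 = 0) (h12 : M 1 2 = 0)
    (h20 : M 2 0 = 0) (h21 : M 2 1 = 0) :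
    VelocityGradient.discr (strainPart M) = 0 := by
  rw [strainPart_eq_diagonal_of_rel M h01 h11 h02 h12 h20 h21,
    VelocityGradient.discr_diagonal_fin_three]
  · simp
  · simp; ring

/-- Orthogonal conjugation commutes with taking the strain germ. -/
theorem strainPart_conj (M P : Matrix (Fin 3) (Fin 3) ℝ) (hP : Pᵀ * P = 1) :
    strainPart (Pᵀ * M * P) = Pᵀ * strainPart M * P := by
  have hP' : P * Pᵀ = 1 := mul_eq_one_comm.mp hP
  have htr : (Pᵀ * M * P).trace = M.trace := by
    rw [Matrix.trace_mul_cycle, hP', Matrix.one_mul]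
  have htrans : (Pᵀ * M * P)ᵀ = Pᵀ * Mᵀ * P := by
    rw [Matrix.transpose_mul, Matrix.transpose_mul, Matrix.transpose_transpose, Matrix.mul_assoc]
  unfold strainPart
  rw [htr, htrans]
  simp only [Matrix.mul_sub, Matrix.sub_mul, Matrix.mul_add, Matrix.add_mul, Matrix.mul_smul,
    Matrix.smul_mul, Matrix.mul_one, Matrix.mul_assoc, hP]

/-- The restricted-Euler discriminant is invariant under orthogonal conjugation. -/
theorem discr_conj_orth (S P : Matrix (Fin 3) (Fin 3) ℝ) (hP : Pᵀ * P = 1) :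
    VelocityGradient.discr (Pᵀ * S * P) = VelocityGradient.discr S := by
  have hinv : (Pᵀ)⁻¹ = P := Matrix.inv_eq_right_inv hP
  have hdet : IsUnit (Pᵀ).det := Matrix.isUnit_det_of_right_inverse hP
  have h : Pᵀ * S * P = Pᵀ * S * (Pᵀ)⁻¹ := by rw [hinv]
  rw [h, VelocityGradient.discr_def, VelocityGradient.discr_def,
    VelocityGradient.invQ_conj S Pᵀ hdet, VelocityGradient.invR_conj S Pᵀ hdet]

/-! The quarter-turn about `e₃` and the standard basis. -/

theorem rotZ_quarter_single_zero :
    rotZ (Real.pi / 2) (EuclideanSpace.single 0 (1 : ℝ)) = EuclideanSpace.single 1 (1 : ℝ) := by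
  ext i; fin_cases i <;> simp [rotZ]

theorem rotZ_quarter_single_one :
    rotZ (Real.pi / 2) (EuclideanSpace.single 1 (1 : ℝ)) = -EuclideanSpace.single 0 (1 : ℝ) := by
  ext i; fin_cases i <;> simp [rotZ]

theorem rotZ_quarter_single_two :
    rotZ (Real.pi / 2) (EuclideanSpace.single 2 (1 : ℝ)) = EuclideanSpace.single 2 (1 : ℝ) := by
  ext i; fin_cases i <;> simp [rotZ]

theorem rotZ_quarter_apply_zero (y : ℝ³) : rotZ (Real.pi / 2) y 0 = -y 1 := by simp [rotZ]
theorem rotZ_quarter_apply_one (y : ℝ³) : rotZ (Real.pi / 2) y 1 = y 0 := by simp [rotZ]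
theorem rotZ_quarter_apply_two (y : ℝ³) : rotZ (Real.pi / 2) y 2 = y 2 := by simp [rotZ]

/-! Coordinates of a linear isometry equivalence and of its inverse (the matrix is orthogonal). -/

/-- The matrix `P k j = (A e_j)_k` of a linear isometry equivalence in the standard basis. -/
noncomputable def isoMatrix (A : ℝ³ ≃ₗᵢ[ℝ] ℝ³) : Matrix (Fin 3) (Fin 3) ℝ :=
  Matrix.of fun k j => (A (EuclideanSpace.single j (1 : ℝ))) k

theorem inner_eq_sum (x y : ℝ³) : inner ℝ x y = ∑ k, x k * y k := by
  simp [PiLp.inner_apply, mul_comm]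

/-- `(A⁻¹ y)_i = Σ_k P_{k i} y_k` (the inverse of an isometry is its transpose). -/
theorem symm_apply_coord (A : ℝ³ ≃ₗᵢ[ℝ] ℝ³) (y : ℝ³) (i : Fin 3) :
    (A.symm y) i = ∑ k, isoMatrix A k i * y k := by
  have h1 : (A.symm y) i = inner ℝ (EuclideanSpace.single i (1 : ℝ)) (A.symm y) := by
    rw [EuclideanSpace.inner_single_left]; simp
  rw [h1, ← A.inner_map_map, A.apply_symm_apply, inner_eq_sum]
  simp [isoMatrix]

/-- Expansion in the standard basis. -/
theorem eq_sum_single (y : ℝ³) : y = ∑ l, y l • EuclideanSpace.single l (1 : ℝ) := by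
  simpa using ((EuclideanSpace.basisFun (Fin 3) ℝ).sum_repr y).symm

/-- `(T (A e_j))_k = Σ_l (T e_l)_k P_{l j}` for a continuous linear map `T`. -/
theorem clm_apply_iso_coord (T : ℝ³ →L[ℝ] ℝ³) (A : ℝ³ ≃ₗᵢ[ℝ] ℝ³) (j k : Fin 3) :
    (T (A (EuclideanSpace.single j (1 : ℝ)))) k =
      ∑ l, (T (EuclideanSpace.single l (1 : ℝ))) k * isoMatrix A l j := by
  have hy := eq_sum_single (A (EuclideanSpace.single j (1 : ℝ)))
  have : T (A (EuclideanSpace.single j (1 : ℝ))) =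
      ∑ l, (A (EuclideanSpace.single j (1 : ℝ))) l • T (EuclideanSpace.single l (1 : ℝ)) := by
    conv_lhs => rw [hy]
    simp [map_sum, map_smul]
  rw [this]
  simp [isoMatrix, Finset.sum_apply, mul_comm]

/-- `PᵀP = 1` for the matrix of a linear isometry equivalence. -/
theorem isoMatrix_orthogonal (A : ℝ³ ≃ₗᵢ[ℝ] ℝ³) : (isoMatrix A)ᵀ * isoMatrix A = 1 := by
  ext i j
  have h : inner ℝ (A (EuclideanSpace.single i (1 : ℝ))) (A (EuclideanSpace.single j (1 : ℝ))) =
      inner ℝ (EuclideanSpace.single i (1 : ℝ)) (EuclideanSpace.single j (1 : ℝ) : ℝ³) :=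
    A.inner_map_map _ _
  rw [inner_eq_sum, EuclideanSpace.inner_single_left] at h
  simp only [map_one, one_mul, PiLp.single_apply] at h
  rw [Matrix.mul_apply, Matrix.one_apply]
  simpa [isoMatrix, Matrix.transpose_apply, eq_comm] using h

/-- The centre gradient of the conjugated field `x ↦ A⁻¹ v (A x)` is the orthogonal conjugate
`Pᵀ (∇v(0)) P` — given the derivative of `v` at `0`. -/
theorem centreGradient_conj (v : ℝ³ → ℝ³) (A : ℝ³ ≃ₗᵢ[ℝ] ℝ³) (Dw : ℝ³ →L[ℝ] ℝ³)
    (hDw : fderiv ℝ (fun x => A.symm (v (A x))) 0 = Dw)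
    (hDw' : ∀ y, Dw y = A.symm (fderiv ℝ v 0 (A y))) :
    centreGradient (fun x => A.symm (v (A x))) = (isoMatrix A)ᵀ * centreGradient v * isoMatrix A := by
  ext i j
  rw [Matrix.mul_assoc, Matrix.mul_apply]
  simp only [centreGradient, Matrix.of_apply, hDw, hDw', Matrix.transpose_apply, Matrix.mul_apply]
  rw [symm_apply_coord]
  refine Finset.sum_congr rfl fun k _ => ?_
  rw [clm_apply_iso_coord]

/-! The germ lemma itself. -/

/-- **A triaxial strain germ at the origin forbids axisymmetry about every line through the origin.** -/
theorem triaxial_noCommonAxis (v : ℝ³ → ℝ³) (η : ℝ) (hη : 0 < η) (hv : DifferentiableAt ℝ v 0)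
    (htri : IsTriaxial η (centreGradient v)) (A : ℝ³ ≃ₗᵢ[ℝ] ℝ³) :
    ¬ IsAxisymmetric (fun x => A.symm (v (A x))) := by
  intro hax
  -- the derivative of the conjugated field at the origin
  set Dv : ℝ³ →L[ℝ] ℝ³ := fderiv ℝ v 0 with hDv_def
  set AL : ℝ³ →L[ℝ] ℝ³ := (A.toContinuousLinearEquiv : ℝ³ →L[ℝ] ℝ³) with hAL_def
  set AiL : ℝ³ →L[ℝ] ℝ³ := (A.symm.toContinuousLinearEquiv : ℝ³ →L[ℝ] ℝ³) with hAiL_def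
  set Dw : ℝ³ →L[ℝ] ℝ³ := AiL.comp (Dv.comp AL) with hDw_def
  have hA0 : A 0 = 0 := map_zero A
  have hw : HasFDerivAt (fun x => A.symm (v (A x))) Dw 0 := by
    have h1 : HasFDerivAt (fun x => A x) AL 0 := by
      simpa using A.toContinuousLinearEquiv.hasFDerivAt (x := (0 : ℝ³))
    have h2 : HasFDerivAt v Dv (A 0) := by rw [hA0]; exact hv.hasFDerivAt
    have h3 : HasFDerivAt (fun x => v (A x)) (Dv.comp AL) 0 := h2.comp 0 h1
    have h4 : HasFDerivAt (fun y => A.symm y) AiL (v (A 0)) :=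
      A.symm.toContinuousLinearEquiv.hasFDerivAt
    exact h4.comp 0 h3
  have hDw' : ∀ y, Dw y = A.symm (fderiv ℝ v 0 (A y)) := by
    intro y; simp [hDw_def, hAiL_def, hAL_def, hDv_def]
  -- the derivative commutes with every rotation about e₃
  have hcomm : ∀ θ : ℝ, ∀ x : ℝ³, Dw (rotZ θ x) = rotZ θ (Dw x) := by
    intro θ x
    set RL : ℝ³ →L[ℝ] ℝ³ := ((rotZLIE θ).toContinuousLinearEquiv : ℝ³ →L[ℝ] ℝ³) with hRL_def
    have hRLapply : ∀ y, RL y = rotZ θ y := by intro y; simp [hRL_def]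
    have hR0 : rotZ θ 0 = 0 := by rw [← hRLapply]; exact map_zero RL
    have hRat : ∀ y : ℝ³, HasFDerivAt (fun x => rotZ θ x) RL y := by
      intro y
      exact (rotZLIE θ).toContinuousLinearEquiv.hasFDerivAt
    have hwR : HasFDerivAt (fun x => A.symm (v (A (rotZ θ x)))) (Dw.comp RL) 0 := by
      have hw' : HasFDerivAt (fun x => A.symm (v (A x))) Dw (rotZ θ 0) := by rw [hR0]; exact hw
      exact hw'.comp 0 (hRat 0)
    have hRw : HasFDerivAt (fun x => rotZ θ (A.symm (v (A x)))) (RL.comp Dw) 0 :=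
      (hRat _).comp 0 hw
    have hfun : (fun x => A.symm (v (A (rotZ θ x)))) = fun x => rotZ θ (A.symm (v (A x))) := by
      funext x; exact hax θ x
    rw [hfun] at hwR
    have hEq : Dw.comp RL = RL.comp Dw := hwR.unique hRw
    have := congrArg (fun f : ℝ³ →L[ℝ] ℝ³ => f x) hEq
    simpa [hRLapply] using this
  -- entries of the centre gradient of the conjugated field
  set Mw := centreGradient (fun x => A.symm (v (A x))) with hMw_def
  have hM : ∀ i j, Mw i j = (Dw (EuclideanSpace.single j (1 : ℝ))) i := by
    intro i j; simp [hMw_def, centreGradient, hw.fderiv]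
  have c0 := hcomm (Real.pi / 2) (EuclideanSpace.single 0 (1 : ℝ))
  rw [rotZ_quarter_single_zero] at c0
  have c1 := hcomm (Real.pi / 2) (EuclideanSpace.single 1 (1 : ℝ))
  rw [rotZ_quarter_single_one, map_neg] at c1
  have c2 := hcomm (Real.pi / 2) (EuclideanSpace.single 2 (1 : ℝ))
  rw [rotZ_quarter_single_two] at c2
  have c0_0 := congrArg (fun z : ℝ³ => z 0) c0
  have c0_1 := congrArg (fun z : ℝ³ => z 1) c0
  have c0_2 := congrArg (fun z : ℝ³ => z 2) c0
  have c1_2 := congrArg (fun z : ℝ³ => z 2) c1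
  have c2_0 := congrArg (fun z : ℝ³ => z 0) c2
  have c2_1 := congrArg (fun z : ℝ³ => z 1) c2
  simp only [rotZ_quarter_apply_zero, rotZ_quarter_apply_one, rotZ_quarter_apply_two] at c0_0 c0_1 c0_2 c1_2 c2_0 c2_1
  have h01 : Mw 0 1 = -Mw 1 0 := by rw [hM, hM]; linarith
  have h11 : Mw 1 1 = Mw 0 0 := by rw [hM, hM]; linarith
  have h02 : Mw 0 2 = 0 := by rw [hM]; linarith
  have h12 : Mw 1 2 = 0 := by rw [hM]; linarith
  have h20 : Mw 2 0 = 0 := by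
    rw [hM]
    have : (-(Dw (EuclideanSpace.single 0 (1 : ℝ)))) 2 = -((Dw (EuclideanSpace.single 0 (1 : ℝ))) 2) := by
      simp
    linarith
  have h21 : Mw 2 1 = 0 := by
    rw [hM]
    have : (-(Dw (EuclideanSpace.single 0 (1 : ℝ)))) 2 = -((Dw (EuclideanSpace.single 0 (1 : ℝ))) 2) := by
      simp
    linarith
  -- axisymmetric germ: discriminant zero
  have hzero : VelocityGradient.discr (strainPart Mw) = 0 :=
    discr_strainPart_eq_zero_of_rel Mw h01 h11 h02 h12 h20 h21
  -- transport to `v` by orthogonal conjugation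
  have hconj : Mw = (isoMatrix A)ᵀ * centreGradient v * isoMatrix A :=
    centreGradient_conj v A Dw hw.fderiv hDw'
  have hP := isoMatrix_orthogonal A
  have hdiscr : VelocityGradient.discr (strainPart Mw) =
      VelocityGradient.discr (strainPart (centreGradient v)) := by
    rw [hconj, strainPart_conj _ _ hP, discr_conj_orth _ _ hP]
  -- contradiction with the triaxial floor
  obtain ⟨hpos, hle⟩ := htri
  have hneg : -η * ((centreGradient v)ᵀ * centreGradient v).trace ^ 3 < 0 := by
    have := pow_pos hpos 3
    nlinarith
  rw [← hdiscr, hzero] at hle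
  linarith

/-! ## §3 Stubs (sorries live ONLY here) -/

/-- **BC5 RUNG (T3 plan-only; THE first prover target of route №8): forward Type-I half-turn blow-up of RUNG TWO with a
non-trivial rotated-DSS tangent flow carrying a TRIAXIAL centre strain germ.** Technique: Chen–Hou-type computer-assisted
profile + stability for the 4-function radial system `(b; a₁₁, a₁₂, a₂₂)(r,t)` of NS_2's half-turn cell (circuit
AGL-RUNG2-STRUCTURE §1 restricted; exact centre laws `ḃ₀ = 5νb″(0) + 3a₃₃(0)b₀`,
`Ȧ₀ = 7νA″(0) − (15/7)sym₀(A₀²) − (1/5)b₀² sym₀(e₃⊗e₃) + C-channel`): a steady state of the similarity dynamics in a frame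
precessing about `e₃` (the profile flow `v`, rotated self-similar ⇒ rotated-DSS with any factor `c > 1` and `R = rotZ θ`),
linearised stability, truncation to finite energy; convergence to the profile in similarity variables IS the tangent clause, and
the profile's triaxial centre germ IS the limit-germ clause. Interface: `HalfTurnForwardBlowup.of_core`. Why it might fail:
NS_2 may be regular in the cell; the blow-up may be off-centre or non-Type-I; every Type-I centre germ may be the axisymmetric
`(1,1,−2)` collapse (inviscid germ rigidity, `κ₁ = 5/7`); the similarity dynamics may have no stable steady/precessing state.
MODEL evidence owed: AGL-T3-1 / AGL-RUNG2-PROBE-1 scans of the cell (centre diagnostics: Type-I fit, triaxiality ratio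
`D/(tr MᵀM)³`, vorticity fraction, horizontal eigenframe angle vs `log(T − t)`), `m = 0` sub-cell as control. -/
theorem stub_bc5_halfturn_two : HalfTurnForwardBlowup 2 := by
  sorry

/-- stub (XL, K1's physics bet inside the cell): forward half-turn DSS-tangent blow-up on a cofinal set of rungs (strain
self-amplification in the low isotypes continued up the ladder inside the `C_2h` cell). Why it might fail: every rung may be
regular from finite-energy data, or blow up only off-centre / non-Type-I / with an axisymmetric or non-self-similar tangent. -/
theorem stub_halfturn_forward_cofinal : ∀ L₀ : ℕ, ∃ L ≥ L₀, HalfTurnForwardBlowup L := by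
  sorry

/-- stub (L): **tangent-flow closure at fixed `L`** — VERBATIM the statement of birth-v4 `Birth.stub_tangent_flow_closure` over
the local copy of `IsForwardDSSBlowup` (ONE lemma serves both skeletons): the pointwise blow-up limit `v` of a finite-energy,
centred Type-I rung-`L` solution is an ancient rung-`L` solution on `(−∞, 0)` (for some pressure `q` and co-band-limited defect
`e`) inside the same Type-I envelope. Print road: KNSS 2009 Lemma 6.1 / proof of Thm 6.2 run for the truncation `NS_L` at fixed
`L` (uniform Type-I bounds ⇒ local parabolic regularity of `NS_L`, `Π_L` being `L^p`-bounded and commuting with `Δ` ⇒ `C^k_loc`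
compactness ⇒ the identity and the (co-)band-limited slice conditions pass to the limit); the `HasTypeIDecay C v` conjunct is
FREE (`IsForwardDSSBlowup.hasTypeIDecay`, §2a). Tree precedents: `AngularLadder.IsRungSolutionOn.nsRescale`,
`IsClassicalNSSolutionOn.nsRescale_translate`, `HasTypeIDecay.of_tendsto`, `rotatedDSS_Iio_of_tendsto`. Why it might fail:
only through a typing gap (e.g. the pressure gauge of `IsRungSolutionOn`, or pointwise convergence being too weak to pass the
identity without the uniform local bounds the proof must first extract), not in substance. -/
theorem stub_halfturn_tangent_closure :
    ∀ (L : ℕ) (T C c : ℝ) (R : ℝ³ ≃ₗᵢ[ℝ] ℝ³) (u : ℝ → ℝ³ → ℝ³) (p : ℝ → ℝ³ → ℝ) (d : ℝ → ℝ³ → ℝ³)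
      (v : ℝ → ℝ³ → ℝ³) (lam : ℕ → ℝ), IsForwardDSSBlowup L T C c R u p d v lam →
      ∃ (q : ℝ → ℝ³ → ℝ) (e : ℝ → ℝ³ → ℝ³),
        AngularLadder.IsRungSolutionOn (Set.Iio 0) 1 L v q e ∧ HasTypeIDecay C v := by
  sorry

/-! ## §4 Compositions (real proofs) -/

/-- **Closure output ⇒ the germ form of the singular half-turn profile** (real proof): close the tangent flow of a v4 rung into
an ancient rung-`L` solution (closure hypothesis), read the DSS data and the envelope off the letter, pass the cell to the limit
(`inHalfTurnCell_of_tangent`) and take the limit germ as typed. -/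
theorem halfTurnSingularGerm_of_closure {L : ℕ}
    (h2 : ∀ (L : ℕ) (T C c : ℝ) (R : ℝ³ ≃ₗᵢ[ℝ] ℝ³) (u : ℝ → ℝ³ → ℝ³) (p : ℝ → ℝ³ → ℝ) (d : ℝ → ℝ³ → ℝ³)
      (v : ℝ → ℝ³ → ℝ³) (lam : ℕ → ℝ), IsForwardDSSBlowup L T C c R u p d v lam →
      ∃ (q : ℝ → ℝ³ → ℝ) (e : ℝ → ℝ³ → ℝ³),
        AngularLadder.IsRungSolutionOn (Set.Iio 0) 1 L v q e ∧ HasTypeIDecay C v)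
    (h : HalfTurnForwardBlowup L) : HalfTurnSingularGerm L := by
  obtain ⟨T, C, c, R, u, p, d, v, lam, hF, hcell, -, -, -, s, hs, hdiff, η, hη, htri⟩ := h
  obtain ⟨q, e, hsol, hI⟩ := h2 L T C c R u p d v lam hF
  obtain ⟨hT, -, -, -, -, -, -, hc, hdss, -, hpos, hlam, hlim⟩ := hF
  exact ⟨C, c, R, v, q, e, ⟨hsol, hc, hdss, hI⟩, inHalfTurnCell_of_tangent hT hcell hpos hlam hlim,
    s, hs, hdiff, η, hη, htri⟩

/-- Germ form ⇒ profile form: a triaxial slice has no axis, hence the slices have no common axis. -/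
theorem HalfTurnSingularGerm.halfTurnSingular_of
    (hT : ∀ (v : ℝ³ → ℝ³) (η : ℝ), 0 < η → DifferentiableAt ℝ v 0 → IsTriaxial η (centreGradient v) →
      ∀ A : ℝ³ ≃ₗᵢ[ℝ] ℝ³, ¬ IsAxisymmetric (fun x => A.symm (v (A x))))
    {L : ℕ} (h : HalfTurnSingularGerm L) : HalfTurnSingular L := by
  obtain ⟨C₀, c, R, u, p, d, hprof, hcell, t₀, ht₀, hdiff, η, hη, htri⟩ := h
  exact ⟨C₀, c, R, u, p, d, hprof, hcell, ⟨t₀, ht₀, exists_ne_zero_of_isTriaxial htri⟩,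
    fun ⟨A, hA⟩ => hT (u t₀) η hη hdiff htri A (hA t₀ ht₀)⟩

/-- Germ form ⇒ profile form, with the germ lemma `triaxial_noCommonAxis` (§2b) plugged in. -/
theorem HalfTurnSingularGerm.halfTurnSingular {L : ℕ} (h : HalfTurnSingularGerm L) : HalfTurnSingular L :=
  h.halfTurnSingular_of triaxial_noCommonAxis

/-- A singular half-turn profile is a singular rung profile (`K1`'s witness shape at level `L`). -/
theorem HalfTurnSingular.rungIsSingular {L : ℕ} (h : HalfTurnSingular L) : AngularLadder.RungIsSingular L := by
  obtain ⟨C₀, c, R, u, p, d, hprof, -, hnz, -⟩ := h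
  exact ⟨C₀, c, R, u, p, d, hprof, hnz⟩

/-- The Tsai-live refinement implies the profile form. -/
theorem HalfTurnSingularRSS.halfTurnSingular {L : ℕ} (h : HalfTurnSingularRSS L) : HalfTurnSingular L := by
  obtain ⟨C₀, c, R, u, p, d, hprof, hcell, hnz, hax, -⟩ := h
  exact ⟨C₀, c, R, u, p, d, hprof, hcell, hnz, hax⟩

/-- A witness of the chain-live profile form escapes the tree's KNSS no-go by construction: its slices admit no common axis,
so the hypothesis `∃ A, ∀ t < 0, IsAxisymmetric (A⁻¹ ∘ u t ∘ A)` of `not_typeI_rdss_profile_of_isAxisymmetric_conj` fails. -/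
theorem HalfTurnSingular.noCommonAxis_witness {L : ℕ} (h : HalfTurnSingular L) :
    ∃ (C₀ c : ℝ) (R : ℝ³ ≃ₗᵢ[ℝ] ℝ³) (u : ℝ → ℝ³ → ℝ³) (p : ℝ → ℝ³ → ℝ) (d : ℝ → ℝ³ → ℝ³),
      AngularLadder.IsRungProfile L C₀ c R u p d ∧ NoCommonAxis u := by
  obtain ⟨C₀, c, R, u, p, d, hprof, -, -, hax⟩ := h
  exact ⟨C₀, c, R, u, p, d, hprof, hax⟩

/-- **Which instances of the crux the BC5 rung settles, and in which class** (real proof from the BC5 letter and the closure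
hypothesis): a v4 rung-2 blow-up yields a singular half-turn rung-2 profile — non-trivial, Type-I, rotated-DSS, slices in the
cell, NO common axis of axisymmetry (outside the KNSS-dead stratum). -/
theorem halfTurnSingular_two_of (h5 : HalfTurnForwardBlowup 2)
    (h2 : ∀ (L : ℕ) (T C c : ℝ) (R : ℝ³ ≃ₗᵢ[ℝ] ℝ³) (u : ℝ → ℝ³ → ℝ³) (p : ℝ → ℝ³ → ℝ) (d : ℝ → ℝ³ → ℝ³)
      (v : ℝ → ℝ³ → ℝ³) (lam : ℕ → ℝ), IsForwardDSSBlowup L T C c R u p d v lam →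
      ∃ (q : ℝ → ℝ³ → ℝ) (e : ℝ → ℝ³ → ℝ³),
        AngularLadder.IsRungSolutionOn (Set.Iio 0) 1 L v q e ∧ HasTypeIDecay C v) :
    HalfTurnSingular 2 :=
  (halfTurnSingularGerm_of_closure h2 h5).halfTurnSingular

/-- Hence every instance `L₀ ≤ 2` of `RungBlowupCofinal = ∀ L₀, ∃ L ≥ L₀, RungIsSingular L` (BC5: a special case of C in a
regime where S is unknown). -/
theorem rungIsSingular_instances_of_two (h : HalfTurnSingular 2) :
    ∀ L₀ ≤ 2, ∃ L ≥ L₀, AngularLadder.RungIsSingular L :=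
  fun _ hL₀ => ⟨2, hL₀, h.rungIsSingular⟩

/-- The instances `L₀ ≤ 2`, consuming the BC5 stub and the closure stub (carries their `sorry`s). -/
theorem rungIsSingular_instances_of_two_skeleton : ∀ L₀ ≤ 2, ∃ L ≥ L₀, AngularLadder.RungIsSingular L :=
  rungIsSingular_instances_of_two (halfTurnSingular_two_of stub_bc5_halfturn_two stub_halfturn_tangent_closure)

/-- **The crux BY NAME from the line's stubs** (real proof): cofinal forward half-turn DSS-tangent blow-up + tangent-flow
closure (+ the triaxial germ lemma) ⇒ `RungBlowupCofinal`. -/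
theorem RungBlowupCofinal_of_halfTurn
    (h1 : ∀ L₀ : ℕ, ∃ L ≥ L₀, HalfTurnForwardBlowup L)
    (h2 : ∀ (L : ℕ) (T C c : ℝ) (R : ℝ³ ≃ₗᵢ[ℝ] ℝ³) (u : ℝ → ℝ³ → ℝ³) (p : ℝ → ℝ³ → ℝ) (d : ℝ → ℝ³ → ℝ³)
      (v : ℝ → ℝ³ → ℝ³) (lam : ℕ → ℝ), IsForwardDSSBlowup L T C c R u p d v lam →
      ∃ (q : ℝ → ℝ³ → ℝ) (e : ℝ → ℝ³ → ℝ³),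
        AngularLadder.IsRungSolutionOn (Set.Iio 0) 1 L v q e ∧ HasTypeIDecay C v)
    (h3 : ∀ (v : ℝ³ → ℝ³) (η : ℝ), 0 < η → DifferentiableAt ℝ v 0 → IsTriaxial η (centreGradient v) →
      ∀ A : ℝ³ ≃ₗᵢ[ℝ] ℝ³, ¬ IsAxisymmetric (fun x => A.symm (v (A x)))) : Goal := by
  show Summit.NavierStokesRegularity.NavierStokesRegularity.Theses.AngularGalerkinLadder.RungBlowupCofinal
  intro L₀
  obtain ⟨L, hL, hB⟩ := h1 L₀
  exact ⟨L, hL, ((halfTurnSingularGerm_of_closure h2 hB).halfTurnSingular_of h3).rungIsSingular⟩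

/-- The hypothesis-free skeleton line (carries the stubs' `sorry`s — decoration, not closure). -/
theorem RungBlowupCofinal_skeleton_halfTurn :
    Summit.NavierStokesRegularity.NavierStokesRegularity.Theses.AngularGalerkinLadder.RungBlowupCofinal :=
  RungBlowupCofinal_of_halfTurn stub_halfturn_forward_cofinal stub_halfturn_tangent_closure triaxial_noCommonAxis
end Summit.NavierStokesRegularity.NavierStokesRegularity.Cruxes.RungBlowupCofinal.HalfTurn
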